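import Literature.Topology.FourManifolds.BandRebuildArches
import Literature.Topology.FourManifolds.ExplicitArch
import HarnessLib

/-!
# Rebuilding a band sum with explicit arches, I: the rail arches

Topic `Literature/Topology/FourManifolds` (trunk T-4MAN). Fact seat
`provefact-Literature.Topology.FourManifolds.Knot.IsConnectedSum.isIsotopic` (Schubert's theorem).
The arches `cLo`, `cUp` of `BandRebuildArches.lean` are chosen from the existential statement
`exists_planarArch`; only their specification is known. For the proof of the geometric heart the
arches must be explicit, and this file provides the explicit replacements, the **rail arches**

* `b.railLo = plateauArch alo tlo epsLo (1/4) fLo gLo` — up the left edge along `A`, across the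
  square at the constant height `1/4` with strictly increasing first coordinate (the *lower rail*),
  down the right edge along `B`;
* `b.railUp` — the upper arch, the plateau arch in the reversed parameter with the height
  reflected (exactly as `cUp` is built from `cUpAux`), with the *upper rail* at height `3/4`;

together with the same API as `cLo`, `cUp` (`railLo_spec`, junction lemmas `band_railLo_eq_A`,
`band_railLo_eq_B`, `band_railUp_eq_A`, `band_railUp_eq_B`, membership `railLo_mem`, `railUp_mem`)
and the additional plateau lemmas (`railLo_of_mem_plateau`, `railUp_of_mem_plateau`,
`strictMonoOn_railLo_zero`, `strictAntiOn_railUp_zero`). All the edge coordinates (`thetaA`, …,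
`fLo`, `gLo`, `fUp`, `gUp`, the marks and margins) are those of `BandRebuildArches.lean`, Part I.
Everything is proved.

## References

Standard; all statements `[folklore]` (band sums: R. E. Gompf, A. I. Stipsicz, *4-Manifolds and
Kirby Calculus* (1999), §5.1).
-/

open scoped Manifold ContDiff Topology Real
open Function Set Metric

noncomputable section

namespace Literature.Topology.FourManifolds

/-- Local notation: `𝔼 n` is the model Euclidean space `EuclideanSpace ℝ (Fin n)`. -/
local notation "𝔼 " n:arg => EuclideanSpace ℝ (Fin n)

/-- Local notation: `𝕊 n` is the unit sphere in `EuclideanSpace ℝ (Fin (n + 1))`. -/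
local notation "𝕊 " n:arg => (Metric.sphere (0 : EuclideanSpace ℝ (Fin (n + 1))) 1)

namespace BandData

variable {A B K : Knot} {avoid : Set (𝕊 3)} (b : BandData A B K avoid)

/-! ### The lower rail arch -/

/-- **The lower rail arch**: the plateau arch (`ExplicitArch.lean`) with the data of the lower arch
of `BandRebuildArches.lean` and plateau height `1/4`. [folklore] -/
def railLo : ℝ → 𝔼 2 := plateauArch b.alo b.tlo b.epsLo (1 / 4) b.fLo b.gLo

/-- The defining properties of `railLo` (the specification of `exists_planarArch`, with the height
clause in min/max form). [folklore] -/
theorem railLo_spec : ContDiff ℝ ∞ b.railLo ∧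
    (∀ t, t ≤ b.alo + b.epsLo → b.railLo t = pt2 0 (b.fLo t)) ∧
    (∀ t, b.tlo - b.epsLo ≤ t → b.railLo t = pt2 1 (b.gLo t)) ∧
    (∀ t ∈ Ioo (b.alo + b.epsLo) (b.tlo - b.epsLo), b.railLo t 0 ∈ Ioo (0 : ℝ) 1) ∧
    (∀ t, b.railLo t 0 ∈ Icc (0 : ℝ) 1) ∧
    (∀ t, b.railLo t 1 ∈ Icc (min (b.fLo t) (min (1 / 4) (b.gLo t))) (max (b.fLo t) (max (1 / 4) (b.gLo t)))) ∧
    Injective b.railLo ∧ ∀ t, deriv b.railLo t ≠ 0 :=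
  plateauArch_spec b.cLo_hyp.1 b.cLo_hyp.2.1 b.fLo_spec.1 b.gLo_spec.1 b.cLo_hyp.2.2.1 b.cLo_hyp.2.2.2

/-- The lower rail arch is `C^∞`. [folklore] -/
theorem contDiff_railLo : ContDiff ℝ ∞ b.railLo := b.railLo_spec.1

/-- Near `alo` the lower rail arch runs up the left edge. [folklore] -/
theorem railLo_eq_left {t : ℝ} (ht : t ≤ b.alo + b.epsLo) : b.railLo t = pt2 0 (b.fLo t) :=
  b.railLo_spec.2.1 t ht

/-- Near `tlo` the lower rail arch runs down the right edge. [folklore] -/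
theorem railLo_eq_right {t : ℝ} (ht : b.tlo - b.epsLo ≤ t) : b.railLo t = pt2 1 (b.gLo t) :=
  b.railLo_spec.2.2.1 t ht

/-- Strictly between the marks the lower rail arch is off the two edges. [folklore] -/
theorem railLo_zero_mem_Ioo {t : ℝ} (ht : t ∈ Ioo (b.alo + b.epsLo) (b.tlo - b.epsLo)) :
    b.railLo t 0 ∈ Ioo (0 : ℝ) 1 :=
  b.railLo_spec.2.2.2.1 t ht

/-- The first coordinate of the lower rail arch lies in `[0, 1]`. [folklore] -/
theorem railLo_zero_mem_Icc (t : ℝ) : b.railLo t 0 ∈ Icc (0 : ℝ) 1 := b.railLo_spec.2.2.2.2.1 t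

/-- The lower rail arch is injective. [folklore] -/
theorem injective_railLo : Injective b.railLo := b.railLo_spec.2.2.2.2.2.2.1

/-- The lower rail arch is regular. [folklore] -/
theorem deriv_railLo_ne_zero (t : ℝ) : deriv b.railLo t ≠ 0 := b.railLo_spec.2.2.2.2.2.2.2 t

/-- **The lower rail**: on the plateau `[alo + 2 epsLo, tlo - 2 epsLo]` the lower rail arch is
`(χ₁ t, 1/4)`. [folklore] -/
theorem railLo_of_mem_plateau {t : ℝ} (ht : t ∈ Icc (b.alo + 2 * b.epsLo) (b.tlo - 2 * b.epsLo)) :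
    b.railLo t = pt2 (smoothStep (b.alo + b.epsLo) (b.tlo - b.epsLo) t) (1 / 4) :=
  plateauArch_of_mem_plateau b.cLo_hyp.1 ht

/-- The height of the lower rail arch on the plateau is `1/4`. [folklore] -/
theorem railLo_one_of_mem_plateau {t : ℝ} (ht : t ∈ Icc (b.alo + 2 * b.epsLo) (b.tlo - 2 * b.epsLo)) :
    b.railLo t 1 = 1 / 4 :=
  plateauArch_one_of_mem_plateau b.cLo_hyp.1 ht

/-- The first coordinate of the lower rail arch is `χ₁ t`. [folklore] -/
theorem railLo_apply_zero (t : ℝ) : b.railLo t 0 = smoothStep (b.alo + b.epsLo) (b.tlo - b.epsLo) t := rfl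

/-- **The first coordinate of the lower rail arch is strictly increasing across the square.**
[folklore] -/
theorem strictMonoOn_railLo_zero :
    StrictMonoOn (fun t ↦ b.railLo t 0) (Icc (b.alo + b.epsLo) (b.tlo - b.epsLo)) :=
  strictMonoOn_plateauArch_zero b.cLo_hyp.1 b.cLo_hyp.2.1

/-- The derivative of the first coordinate of the lower rail arch is positive strictly inside.
[folklore] -/
theorem deriv_railLo_zero_pos {t : ℝ} (ht : t ∈ Ioo (b.alo + b.epsLo) (b.tlo - b.epsLo)) :
    0 < deriv (fun t ↦ b.railLo t 0) t :=
  deriv_plateauArch_zero_pos b.cLo_hyp.1 b.cLo_hyp.2.1 ht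

/-- **Lower junction with `A`.** For `t ∈ [thetaA (3/20), alo + epsLo]` the band image of the lower
rail arch is the point of `A` with parameter `t`. [folklore] -/
theorem band_railLo_eq_A {t : ℝ} (ht : t ∈ Icc (b.thetaA (3 / 20)) (b.alo + b.epsLo)) :
    b.band (b.railLo t) = A (circlePt t) := by
  have hm := b.marks_lt
  obtain ⟨hε, hε1, -⟩ := b.epsLo_bounds
  rw [b.railLo_eq_left ht.2, (b.fLo_eq_heightA ⟨ht.1, by linarith [ht.2]⟩).1,
    b.band_pt2_zero_heightA ⟨by linarith [ht.1], by linarith [ht.2]⟩]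

/-- **Lower junction with `B`.** For `t ∈ [tlo - epsLo, psiInv (thetaB (3/20))]` the band image of
the lower rail arch is the point of `B` with parameter `psi t`. [folklore] -/
theorem band_railLo_eq_B {t : ℝ} (ht : t ∈ Icc (b.tlo - b.epsLo) (b.psiInv (b.thetaB (3 / 20)))) :
    b.band (b.railLo t) = B (circlePt (b.psi t)) := by
  obtain ⟨h1, h2⟩ := b.tlo_marksB
  rw [b.railLo_eq_right ht.1, b.gLo_spec.2.1 t ⟨by linarith [ht.1], ht.2⟩]
  apply b.band_pt2_one_heightB
  have hs1 := b.strictMono_psi.monotone ht.2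
  have hs0 : b.psi (b.psiInv (b.thetaB (7 / 20))) ≤ b.psi t := b.strictMono_psi.monotone (by linarith [ht.1])
  rw [psi_psiInv] at hs1 hs0
  exact ⟨(b.strictAntiOn_thetaB (by norm_num) (by norm_num) (by norm_num : (7 / 20 : ℝ) < 9 / 10)).le.trans hs0,
    hs1.trans (b.strictAntiOn_thetaB (by norm_num) (by norm_num) (by norm_num : (10⁻¹ : ℝ) < 3 / 20)).le⟩

/-- **Heights of the lower rail arch over `[alo, tlo]`** lie in `(1/10, 2/5)`, and the arch lies in
the square neighbourhood. [folklore] -/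
theorem railLo_mem {t : ℝ} (ht : t ∈ Icc b.alo b.tlo) :
    b.railLo t ∈ squareNhd b.δ ∧ b.railLo t 1 ∈ Ioo (10⁻¹ : ℝ) (2 / 5) := by
  have hm := b.marks_lt
  have hδ := b.δ_pos
  have hx0 := b.railLo_zero_mem_Icc t
  have hx1 := b.railLo_spec.2.2.2.2.2.1 t
  obtain ⟨hf, hfm⟩ := b.fLo_eq_heightA ⟨by linarith [ht.1], ht.2⟩
  have hg := b.gLo_mem (ht.2.trans b.tlo_marksB.1.le)
  have hx1' : b.railLo t 1 ∈ Ioo (10⁻¹ : ℝ) (2 / 5) := by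
    rw [hf] at hx1
    have hlo : (10⁻¹ : ℝ) < min (b.heightA t) (min (1 / 4) (b.gLo t)) :=
      lt_min (by linarith [hfm.1]) (lt_min (by norm_num) hg.1)
    have hhi : max (b.heightA t) (max (1 / 4) (b.gLo t)) < 2 / 5 :=
      max_lt (by linarith [hfm.2]) (max_lt (by norm_num) hg.2)
    exact ⟨hlo.trans_le hx1.1, hx1.2.trans_lt hhi⟩
  refine ⟨?_, hx1'⟩
  rw [mem_squareNhd_iff, Fin.forall_fin_two]
  exact ⟨⟨by linarith [hx0.1], by linarith [hx0.2]⟩, ⟨by linarith [hx1'.1], by linarith [hx1'.2]⟩⟩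

/-! ### The upper rail arch -/

/-- The auxiliary plateau arch of the upper rail arch in the reversed parameter (`f v = -fUp (-v)`,
`g v = -gUp (-v)`, plateau height `-3/4`). [folklore] -/
def railUpAux : ℝ → 𝔼 2 :=
  plateauArch (-b.ahi) (-b.thi) b.epsHi (-(3 / 4)) (fun v ↦ -b.fUp (-v)) (fun v ↦ -b.gUp (-v))

/-- The defining properties of `railUpAux`. [folklore] -/
theorem railUpAux_spec : ContDiff ℝ ∞ b.railUpAux ∧
    (∀ v, v ≤ -b.ahi + b.epsHi → b.railUpAux v = pt2 0 (-b.fUp (-v))) ∧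
    (∀ v, -b.thi - b.epsHi ≤ v → b.railUpAux v = pt2 1 (-b.gUp (-v))) ∧
    (∀ v ∈ Ioo (-b.ahi + b.epsHi) (-b.thi - b.epsHi), b.railUpAux v 0 ∈ Ioo (0 : ℝ) 1) ∧
    (∀ v, b.railUpAux v 0 ∈ Icc (0 : ℝ) 1) ∧
    (∀ v, b.railUpAux v 1 ∈ Icc (min (-b.fUp (-v)) (min (-(3 / 4)) (-b.gUp (-v))))
      (max (-b.fUp (-v)) (max (-(3 / 4)) (-b.gUp (-v))))) ∧
    Injective b.railUpAux ∧ ∀ v, deriv b.railUpAux v ≠ 0 :=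
  plateauArch_spec b.cUp_hyp.1 b.cUp_hyp.2.1 (b.fUp_spec.1.comp contDiff_neg).neg
    (b.gUp_spec.1.comp contDiff_neg).neg b.cUp_hyp.2.2.1 b.cUp_hyp.2.2.2

/-- **The upper rail arch**: the auxiliary arch read backwards with the height reflected back.
[folklore] -/
def railUp (t : ℝ) : 𝔼 2 := pt2 (b.railUpAux (-t) 0) (-(b.railUpAux (-t) 1))

/-- First coordinate of the upper rail arch. [folklore] -/
@[simp] theorem railUp_apply_zero (t : ℝ) : b.railUp t 0 = b.railUpAux (-t) 0 := rfl

/-- Second coordinate of the upper rail arch. [folklore] -/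
@[simp] theorem railUp_apply_one (t : ℝ) : b.railUp t 1 = -(b.railUpAux (-t) 1) := rfl

/-- The upper rail arch is `C^∞`. [folklore] -/
theorem contDiff_railUp : ContDiff ℝ ∞ b.railUp := by
  rw [contDiff_euclidean]
  intro i
  fin_cases i
  · exact (contDiff_apply_of_contDiff b.railUpAux_spec.1 0).comp contDiff_neg
  · exact ((contDiff_apply_of_contDiff b.railUpAux_spec.1 1).comp contDiff_neg).neg

/-- Near `ahi` the upper rail arch runs up the left edge. [folklore] -/
theorem railUp_eq_left {t : ℝ} (ht : b.ahi - b.epsHi ≤ t) : b.railUp t = pt2 0 (b.fUp t) := by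
  have h := b.railUpAux_spec.2.1 (-t) (by linarith)
  ext i
  fin_cases i
  · simp [railUp, h, pt2_apply_zero]
  · simp [railUp, h, pt2_apply_one, neg_neg]

/-- Near `thi` the upper rail arch runs down the right edge. [folklore] -/
theorem railUp_eq_right {t : ℝ} (ht : t ≤ b.thi + b.epsHi) : b.railUp t = pt2 1 (b.gUp t) := by
  have h := b.railUpAux_spec.2.2.1 (-t) (by linarith)
  ext i
  fin_cases i
  · simp [railUp, h, pt2_apply_zero]
  · simp [railUp, h, pt2_apply_one, neg_neg]

/-- **The upper rail**: on the plateau `[thi + 2 epsHi, ahi - 2 epsHi]` the upper rail arch is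
`(χ t, 3/4)` with `χ` the reversed smooth step (decreasing from `1` to `0`). [folklore] -/
theorem railUp_of_mem_plateau {t : ℝ} (ht : t ∈ Icc (b.thi + 2 * b.epsHi) (b.ahi - 2 * b.epsHi)) :
    b.railUp t = pt2 (smoothStep (-b.ahi + b.epsHi) (-b.thi - b.epsHi) (-t)) (3 / 4) := by
  have h := plateauArch_of_mem_plateau (θ₁ := -b.ahi) (θ₂ := -b.thi) (y := -(3 / 4 : ℝ))
    (f := fun v ↦ -b.fUp (-v)) (g := fun v ↦ -b.gUp (-v)) b.cUp_hyp.1 (θ := -t)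
    ⟨by linarith [ht.2], by linarith [ht.1]⟩
  ext i
  fin_cases i
  · simp [railUp, railUpAux, h, pt2_apply_zero]
  · simp [railUp, railUpAux, h, pt2_apply_one]

/-- The height of the upper rail arch on the plateau is `3/4`. [folklore] -/
theorem railUp_one_of_mem_plateau {t : ℝ} (ht : t ∈ Icc (b.thi + 2 * b.epsHi) (b.ahi - 2 * b.epsHi)) :
    b.railUp t 1 = 3 / 4 := by
  rw [b.railUp_of_mem_plateau ht, pt2_apply_one]

/-- Strictly between the marks the upper rail arch is off the two edges. [folklore] -/
theorem railUp_zero_mem_Ioo {t : ℝ} (ht : t ∈ Ioo (b.thi + b.epsHi) (b.ahi - b.epsHi)) :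
    b.railUp t 0 ∈ Ioo (0 : ℝ) 1 :=
  b.railUpAux_spec.2.2.2.1 (-t) ⟨by linarith [ht.2], by linarith [ht.1]⟩

/-- The first coordinate of the upper rail arch lies in `[0, 1]`. [folklore] -/
theorem railUp_zero_mem_Icc (t : ℝ) : b.railUp t 0 ∈ Icc (0 : ℝ) 1 := b.railUpAux_spec.2.2.2.2.1 (-t)

/-- **The first coordinate of the upper rail arch is strictly decreasing across the square.**
[folklore] -/
theorem strictAntiOn_railUp_zero :
    StrictAntiOn (fun t ↦ b.railUp t 0) (Icc (b.thi + b.epsHi) (b.ahi - b.epsHi)) := by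
  intro s hs t ht hst
  have h := strictMonoOn_plateauArch_zero (y := -(3 / 4 : ℝ)) (f := fun v ↦ -b.fUp (-v))
    (g := fun v ↦ -b.gUp (-v)) b.cUp_hyp.1 b.cUp_hyp.2.1
  simp only [railUp_apply_zero, railUpAux]
  exact h ⟨by linarith [ht.2], by linarith [ht.1]⟩ ⟨by linarith [hs.2], by linarith [hs.1]⟩ (by linarith)

/-- The height of the upper rail arch lies between the least and the largest of `gUp t`, `3/4`,
`fUp t`. [folklore] -/
theorem railUp_one_mem_Icc (t : ℝ) :
    b.railUp t 1 ∈ Icc (min (b.fUp t) (min (3 / 4) (b.gUp t))) (max (b.fUp t) (max (3 / 4) (b.gUp t))) := by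
  have h := b.railUpAux_spec.2.2.2.2.2.1 (-t)
  simp only [neg_neg] at h
  rw [railUp_apply_one]
  obtain ⟨h1, h2⟩ := h
  constructor
  · -- `-(aux) ≥ min` iff `aux ≤ -min = max of negatives`
    have : b.railUpAux (-t) 1 ≤ -min (b.fUp t) (min (3 / 4) (b.gUp t)) := by
      refine h2.trans ?_
      simp only [max_le_iff]
      refine ⟨?_, ?_, ?_⟩
      · linarith [min_le_left (b.fUp t) (min (3 / 4) (b.gUp t))]
      · linarith [min_le_right (b.fUp t) (min (3 / 4) (b.gUp t)), min_le_left (3 / 4 : ℝ) (b.gUp t)]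
      · linarith [min_le_right (b.fUp t) (min (3 / 4) (b.gUp t)), min_le_right (3 / 4 : ℝ) (b.gUp t)]
    linarith
  · have : -max (b.fUp t) (max (3 / 4) (b.gUp t)) ≤ b.railUpAux (-t) 1 := by
      refine le_trans ?_ h1
      simp only [le_min_iff]
      refine ⟨?_, ?_, ?_⟩
      · linarith [le_max_left (b.fUp t) (max (3 / 4) (b.gUp t))]
      · linarith [le_max_right (b.fUp t) (max (3 / 4) (b.gUp t)), le_max_left (3 / 4 : ℝ) (b.gUp t)]
      · linarith [le_max_right (b.fUp t) (max (3 / 4) (b.gUp t)), le_max_right (3 / 4 : ℝ) (b.gUp t)]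
    linarith

/-- The upper rail arch is injective. [folklore] -/
theorem injective_railUp : Injective b.railUp := by
  intro s t hst
  have h0 : b.railUpAux (-s) 0 = b.railUpAux (-t) 0 := by rw [← railUp_apply_zero, ← railUp_apply_zero, hst]
  have h1 : b.railUpAux (-s) 1 = b.railUpAux (-t) 1 := by
    have := congrArg (fun x : 𝔼 2 ↦ x 1) hst
    simpa using this
  have : b.railUpAux (-s) = b.railUpAux (-t) := by
    ext i; fin_cases i <;> assumption
  exact neg_injective (b.railUpAux_spec.2.2.2.2.2.2.1 this)

/-- The upper rail arch is regular. [folklore] -/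
theorem deriv_railUp_ne_zero (t : ℝ) : deriv b.railUp t ≠ 0 := by
  have hd : Differentiable ℝ b.railUpAux := b.railUpAux_spec.1.differentiable (by simp)
  have hne := b.railUpAux_spec.2.2.2.2.2.2.2 (-t)
  have hcomp : HasDerivAt (fun s ↦ b.railUpAux (-s)) ((-1 : ℝ) • deriv b.railUpAux (-t)) t :=
    (hd (-t)).hasDerivAt.scomp t (hasDerivAt_neg t)
  have h0 : HasDerivAt (fun s ↦ b.railUpAux (-s) 0) (-(deriv b.railUpAux (-t) 0)) t := by
    have h' := (EuclideanSpace.proj (0 : Fin 2) : 𝔼 2 →L[ℝ] ℝ).hasFDerivAt.comp_hasDerivAt t hcomp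
    have e : (EuclideanSpace.proj (0 : Fin 2) : 𝔼 2 →L[ℝ] ℝ) ((-1 : ℝ) • deriv b.railUpAux (-t)) =
        -(deriv b.railUpAux (-t) 0) := by simp
    exact e ▸ h'
  have h1 : HasDerivAt (fun s ↦ -(b.railUpAux (-s) 1)) (deriv b.railUpAux (-t) 1) t := by
    have h' := ((EuclideanSpace.proj (1 : Fin 2) : 𝔼 2 →L[ℝ] ℝ).hasFDerivAt.comp_hasDerivAt t hcomp).neg
    have e : -(EuclideanSpace.proj (1 : Fin 2) : 𝔼 2 →L[ℝ] ℝ) ((-1 : ℝ) • deriv b.railUpAux (-t)) =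
        deriv b.railUpAux (-t) 1 := by simp
    exact e ▸ h'
  have hc : HasDerivAt b.railUp (pt2 (-(deriv b.railUpAux (-t) 0)) (deriv b.railUpAux (-t) 1)) t :=
    hasDerivAt_pt2 h0 h1
  rw [hc.deriv]
  intro h
  apply hne
  have e0 : deriv b.railUpAux (-t) 0 = 0 := by
    have := congrArg (fun x : 𝔼 2 ↦ x 0) h; simpa using this
  have e1 : deriv b.railUpAux (-t) 1 = 0 := by
    have := congrArg (fun x : 𝔼 2 ↦ x 1) h; simpa using this
  ext i; fin_cases i
  · exact e0
  · exact e1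

/-- **Upper junction with `A`.** For `t ∈ [ahi - epsHi, thetaA (17/20)]`:
`band (railUp t) = A (circlePt t)`. [folklore] -/
theorem band_railUp_eq_A {t : ℝ} (ht : t ∈ Icc (b.ahi - b.epsHi) (b.thetaA (17 / 20))) :
    b.band (b.railUp t) = A (circlePt t) := by
  have hm := b.marks_lt
  obtain ⟨hε, hε1, -⟩ := b.epsHi_bounds
  rw [b.railUp_eq_left ht.1, (b.fUp_eq_heightA ⟨by linarith [ht.1], ht.2⟩).1,
    b.band_pt2_zero_heightA ⟨by linarith [ht.1], by linarith [ht.2]⟩]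

/-- **Upper junction with `B`.** For `t ∈ [psiInv (thetaB (17/20) + 1), thi + epsHi]`:
`band (railUp t) = B (circlePt (psi t))`. [folklore] -/
theorem band_railUp_eq_B {t : ℝ} (ht : t ∈ Icc (b.psiInv (b.thetaB (17 / 20) + 1)) (b.thi + b.epsHi)) :
    b.band (b.railUp t) = B (circlePt (b.psi t)) := by
  obtain ⟨h1, h2⟩ := b.thi_marksB
  obtain ⟨hε, -, -⟩ := b.epsHi_bounds
  rw [b.railUp_eq_right ht.2, b.gUp_spec.2.1 t ⟨ht.1, by linarith [ht.2]⟩]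
  have hper : circlePt (b.psi t) = circlePt (b.psi t - 1) := by
    conv_lhs => rw [show b.psi t = b.psi t - 1 + 1 by ring, circlePt_add_one]
  rw [hper]
  apply b.band_pt2_one_heightB
  have hs1 := b.strictMono_psi.monotone ht.1
  have hs2 : b.psi t ≤ b.psi (b.psiInv (b.thetaB (13 / 20) + 1)) :=
    b.strictMono_psi.monotone (by linarith [ht.2])
  rw [psi_psiInv] at hs1 hs2
  constructor
  · linarith [b.strictAntiOn_thetaB (by norm_num) (by norm_num) (by norm_num : (17 / 20 : ℝ) < 9 / 10)]
  · linarith [b.strictAntiOn_thetaB (by norm_num) (by norm_num) (by norm_num : (10⁻¹ : ℝ) < 13 / 20)]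

/-- **Heights of the upper rail arch over `[thi, ahi]`** lie in `(3/5, 9/10)`, and the arch lies in
the square neighbourhood. [folklore] -/
theorem railUp_mem {t : ℝ} (ht : t ∈ Icc b.thi b.ahi) :
    b.railUp t ∈ squareNhd b.δ ∧ b.railUp t 1 ∈ Ioo (3 / 5 : ℝ) (9 / 10) := by
  have hm := b.marks_lt
  have hδ := b.δ_pos
  have hx0 := b.railUp_zero_mem_Icc t
  have hx1 := b.railUp_one_mem_Icc t
  obtain ⟨hf, hfm⟩ := b.fUp_eq_heightA ⟨ht.1, by linarith [ht.2]⟩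
  have hg := b.gUp_mem (b.thi_marksB.1.le.trans ht.1)
  have hx1' : b.railUp t 1 ∈ Ioo (3 / 5 : ℝ) (9 / 10) := by
    rw [hf] at hx1
    have hlo : (3 / 5 : ℝ) < min (b.heightA t) (min (3 / 4) (b.gUp t)) :=
      lt_min (by linarith [hfm.1]) (lt_min (by norm_num) hg.1)
    have hhi : max (b.heightA t) (max (3 / 4) (b.gUp t)) < 9 / 10 :=
      max_lt (by linarith [hfm.2]) (max_lt (by norm_num) hg.2)
    exact ⟨hlo.trans_le hx1.1, hx1.2.trans_lt hhi⟩
  refine ⟨?_, hx1'⟩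
  rw [mem_squareNhd_iff, Fin.forall_fin_two]
  exact ⟨⟨by linarith [hx0.1], by linarith [hx0.2]⟩, ⟨by linarith [hx1'.1], by linarith [hx1'.2]⟩⟩

end BandData

end Literature.Topology.FourManifolds
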